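import Mathlib.MeasureTheory.Integral.Asymptotics
import Summits.AtomisticToContinuum.Crystallization.Theorems.FreeSplittingCertificatesStrictSplittingRuleFarPencilDecay
import Summits.AtomisticToContinuum.Crystallization.Theorems.FreeSplittingCertificatesStrictSplittingRuleFarPencilWeightedIntegrable

/-!
# `StrictSplittingRule` (stmt-AtomisticToContinuum-12560): decay gauges of the far-pencil densities along a field of LINEAR GROWTH

Route `FreeSplittingCertificates`, crux r3 `StrictSplittingRule` (H12⋆ = `stub_coreJointCoercive`), unit b2b-freesplit-B gen 12.
VALUE = the decay bookkeeping that turns the integrability form of the weighted continuum far pencil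
(`farPencil_weighted_integral_le_of_integrable`, `…FarPencilWeightedIntegrable`, gen 11) into a statement about a CLASS OF FIELDS:
`C²` fields `v` with `v = O(‖y‖)`, `∇v = O(1)`, `∇²v = O(1)` at infinity (along `Filter.cocompact ℝ³`) — the class containing the
affine-tailed far field `v = −u_P − W(y − y_P)` of the H12⋆ architecture (HOME FAR-LEMMA-SPEC §7 (f)(iv), CERT §18).

Content (all asymptotics along `cocompact (Fin 3 → ℝ)`, gauges `‖y‖ᵏ`, `k : ℤ`, sup norm):
* gauge algebra (`isBigO_gauge_mul/_mono/_up/_mul'/_pow`, constants, coordinates, `(fpSq y)⁻¹ = O(‖y‖⁻²)`);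
* `integrable_of_isBigO_gauge`: continuous and `O(‖y‖ᵏ)` with `k ≤ −4` ⇒ integrable on `ℝ³` (Mathlib `integrable_one_add_norm`, `finrank 3 < 4`,
  `LocallyIntegrable.integrable_of_isBigO_cocompact`);
* along a linear-growth field: `|v|² , ⟪y,v⟫ = O(‖y‖²)`, `tr ∇v, |∇v|², Rec(∇v) = O(1)`, **`Num = O(‖y‖⁻⁶)`, `Den = O(‖y‖⁻⁶)`, `Φⱼ = O(‖y‖⁻⁵)`**.
The flux derivative `∂ₖΦⱼ = O(‖y‖⁻⁵)`, the continuity of the weighted integrands and the resulting weighted far-pencil theorem for the class are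
in the companion file `…FarPencilGrowthIntegral`.  HONEST FRAMING: calculus bookkeeping for test fields; the lattice→continuum transfer and the
near certificate are untouched; NOT a proof of H12⋆, NOT summit progress.
-/

noncomputable section

open MeasureTheory Topology Filter Asymptotics

namespace Summit.AtomisticToContinuum.Crystallization.Theorems.StrictSplittingRuleBirth

/-! ## Gauges `‖y‖ᵏ` along `cocompact ℝ³` -/

/-- Eventually along `cocompact ℝ³`, `R ≤ ‖y‖`. -/
theorem eventually_cocompact_norm_ge (R : ℝ) : ∀ᶠ y : Fin 3 → ℝ in cocompact (Fin 3 → ℝ), R ≤ ‖y‖ := by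
  have h : (Metric.closedBall (0 : Fin 3 → ℝ) R)ᶜ ∈ cocompact (Fin 3 → ℝ) :=
    (isCompact_closedBall (0 : Fin 3 → ℝ) R).compl_mem_cocompact
  filter_upwards [h] with y hy
  have h' : ¬ dist y 0 ≤ R := fun h'' => hy (Metric.mem_closedBall.2 h'')
  rw [dist_zero_right] at h'
  exact le_of_lt (not_le.1 h')

/-- Gauge product: `‖y‖^m · ‖y‖^n =O ‖y‖^(m+n)`. -/
theorem isBigO_gauge_mul (m n : ℤ) :
    (fun y : Fin 3 → ℝ => ‖y‖ ^ m * ‖y‖ ^ n) =O[cocompact (Fin 3 → ℝ)] (fun y => ‖y‖ ^ (m + n)) := by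
  refine IsBigO.of_bound 1 ?_
  filter_upwards [eventually_cocompact_norm_ge 1] with y hy
  have h0 : ‖y‖ ≠ 0 := by positivity
  rw [← zpow_add₀ h0, one_mul]

/-- Gauge monotonicity: `‖y‖^m =O ‖y‖^n` for `m ≤ n`. -/
theorem isBigO_gauge_mono {m n : ℤ} (h : m ≤ n) :
    (fun y : Fin 3 → ℝ => ‖y‖ ^ m) =O[cocompact (Fin 3 → ℝ)] (fun y => ‖y‖ ^ n) := by
  refine IsBigO.of_bound 1 ?_
  filter_upwards [eventually_cocompact_norm_ge 1] with y hy
  rw [one_mul, Real.norm_of_nonneg (zpow_nonneg (norm_nonneg _) _),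
    Real.norm_of_nonneg (zpow_nonneg (norm_nonneg _) _)]
  exact zpow_le_zpow_right₀ hy h

variable {f g : (Fin 3 → ℝ) → ℝ}

/-- Re-gauge: `f =O ‖y‖^m`, `m ≤ n` ⇒ `f =O ‖y‖^n`. -/
theorem isBigO_gauge_up {m n : ℤ} (hf : f =O[cocompact (Fin 3 → ℝ)] fun y => ‖y‖ ^ m) (h : m ≤ n) :
    f =O[cocompact (Fin 3 → ℝ)] fun y => ‖y‖ ^ n :=
  hf.trans (isBigO_gauge_mono h)

/-- Product rule for gauges. -/
theorem isBigO_gauge_mul' {m n : ℤ} (hf : f =O[cocompact (Fin 3 → ℝ)] fun y => ‖y‖ ^ m)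
    (hg : g =O[cocompact (Fin 3 → ℝ)] fun y => ‖y‖ ^ n) :
    (fun y => f y * g y) =O[cocompact (Fin 3 → ℝ)] fun y => ‖y‖ ^ (m + n) :=
  (hf.mul hg).trans (isBigO_gauge_mul m n)

/-- Power rule for gauges. -/
theorem isBigO_gauge_pow {m : ℤ} (hf : f =O[cocompact (Fin 3 → ℝ)] fun y => ‖y‖ ^ m) (k : ℕ) :
    (fun y => f y ^ k) =O[cocompact (Fin 3 → ℝ)] fun y => ‖y‖ ^ (m * k) := by
  refine (hf.pow k).trans (IsBigO.of_bound 1 (Filter.Eventually.of_forall fun y => ?_))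
  rw [one_mul, zpow_mul, zpow_natCast]

/-- Division by a constant keeps the gauge. -/
theorem isBigO_gauge_div_const {m : ℤ} (hf : f =O[cocompact (Fin 3 → ℝ)] fun y => ‖y‖ ^ m) (c : ℝ) :
    (fun y => f y / c) =O[cocompact (Fin 3 → ℝ)] fun y => ‖y‖ ^ m :=
  (hf.const_mul_left c⁻¹).congr_left fun y => by rw [div_eq_inv_mul]

/-- Constants are `O(‖y‖⁰)`. -/
theorem isBigO_const_gauge (c : ℝ) :
    (fun _ : Fin 3 → ℝ => c) =O[cocompact (Fin 3 → ℝ)] fun y => ‖y‖ ^ (0 : ℤ) := by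
  refine IsBigO.of_bound ‖c‖ (Filter.Eventually.of_forall fun y => ?_)
  simp

/-- Coordinates are `O(‖y‖¹)`. -/
theorem isBigO_coord_gauge (j : Fin 3) :
    (fun y : Fin 3 → ℝ => y j) =O[cocompact (Fin 3 → ℝ)] fun y => ‖y‖ ^ (1 : ℤ) := by
  refine IsBigO.of_bound 1 (Filter.Eventually.of_forall fun y => ?_)
  rw [zpow_one, one_mul, norm_norm]
  exact norm_le_pi_norm y j

/-- `|y|⁻² = O(‖y‖⁻²)` (Euclidean square versus sup norm). -/
theorem isBigO_fpSq_inv_gauge :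
    (fun y : Fin 3 → ℝ => (fpSq y)⁻¹) =O[cocompact (Fin 3 → ℝ)] fun y => ‖y‖ ^ (-2 : ℤ) := by
  refine IsBigO.of_bound 1 ?_
  filter_upwards [eventually_cocompact_norm_ge 1] with y hy
  have hs : ‖y‖ ^ 2 ≤ fpSq y := norm_sq_le_fpSq y
  have hp : 0 < ‖y‖ ^ 2 := by positivity
  have h1 : (fpSq y)⁻¹ ≤ (‖y‖ ^ 2)⁻¹ := inv_anti₀ hp hs
  have h2 : 0 ≤ (fpSq y)⁻¹ := inv_nonneg.2 (hp.le.trans hs)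
  rw [one_mul, Real.norm_of_nonneg h2, Real.norm_of_nonneg (zpow_nonneg (norm_nonneg _) _), zpow_neg, zpow_ofNat]
  exact h1

/-- Powers of `|y|⁻²`: `(fpSq y)⁻ᵏ = O(‖y‖⁻²ᵏ)`. -/
theorem isBigO_fpSq_inv_pow_gauge (k : ℕ) :
    (fun y : Fin 3 → ℝ => (fpSq y)⁻¹ ^ k) =O[cocompact (Fin 3 → ℝ)] fun y => ‖y‖ ^ (-2 * (k : ℤ)) :=
  isBigO_gauge_pow isBigO_fpSq_inv_gauge k

/-- `⟪y, eₖ⟫ = O(‖y‖)`. -/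
theorem isBigO_dotE_gauge (k : Fin 3) :
    (fun y : Fin 3 → ℝ => fpDot y (fpE k)) =O[cocompact (Fin 3 → ℝ)] fun y => ‖y‖ ^ (1 : ℤ) := by
  have h : ∀ i : Fin 3, (fun y : Fin 3 → ℝ => y i * fpE k i) =O[cocompact (Fin 3 → ℝ)] fun y => ‖y‖ ^ (1 : ℤ) :=
    fun i => isBigO_gauge_up (isBigO_gauge_mul' (isBigO_coord_gauge i) (isBigO_const_gauge (fpE k i))) (by norm_num)
  exact ((h 0).add (h 1)).add (h 2)

/-- **Decay gauge ⇒ integrable**: a continuous `f = O(‖y‖ᵏ)` at infinity with `k ≤ −4` is integrable on `ℝ³`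
(`(1+‖y‖)⁻⁴` is integrable in dimension `3 < 4`). -/
theorem integrable_of_isBigO_gauge (hf : Continuous f) {k : ℤ} (hk : k ≤ -4)
    (h : f =O[cocompact (Fin 3 → ℝ)] fun y => ‖y‖ ^ k) : Integrable f := by
  have h4 : f =O[cocompact (Fin 3 → ℝ)] fun y => ‖y‖ ^ (-4 : ℤ) := isBigO_gauge_up h hk
  have hg : (fun y : Fin 3 → ℝ => ‖y‖ ^ (-4 : ℤ)) =O[cocompact (Fin 3 → ℝ)]
      fun y => (1 + ‖y‖) ^ (-(4 : ℝ)) := by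
    refine IsBigO.of_bound 16 ?_
    filter_upwards [eventually_cocompact_norm_ge 1] with y hy
    have hr : 0 < ‖y‖ := by linarith
    have hq : 0 < 1 + ‖y‖ := by linarith
    have hpow : (1 + ‖y‖) ^ (-(4 : ℝ)) = ((1 + ‖y‖) ^ 4)⁻¹ := by
      rw [Real.rpow_neg hq.le, show (4 : ℝ) = ((4 : ℕ) : ℝ) by norm_num, Real.rpow_natCast]
    have h1 : (1 + ‖y‖) ^ 4 ≤ 16 * ‖y‖ ^ 4 :=
      calc (1 + ‖y‖) ^ 4 ≤ (2 * ‖y‖) ^ 4 := pow_le_pow_left₀ hq.le (by linarith) 4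
        _ = 16 * ‖y‖ ^ 4 := by ring
    rw [hpow, Real.norm_of_nonneg (zpow_nonneg hr.le _), Real.norm_of_nonneg (by positivity), zpow_neg,
      zpow_ofNat]
    calc (‖y‖ ^ 4)⁻¹ = 16 * (16 * ‖y‖ ^ 4)⁻¹ := by field_simp
      _ ≤ 16 * ((1 + ‖y‖) ^ 4)⁻¹ := mul_le_mul_of_nonneg_left (inv_anti₀ (by positivity) h1) (by norm_num)
  have hI : Integrable (fun y : Fin 3 → ℝ => (1 + ‖y‖) ^ (-(4 : ℝ))) := by
    have hrank : (Module.finrank ℝ (Fin 3 → ℝ) : ℝ) < 4 := by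
      rw [Module.finrank_fin_fun]; norm_num
    exact integrable_one_add_norm hrank
  exact (hf.locallyIntegrable (μ := volume)).integrable_of_isBigO_cocompact (h4.trans hg)
    (hI.integrableAtFilter _)

/-! ## Densities along a field of linear growth: `v = O(‖y‖)`, `∇v = O(1)` -/

section growthV
variable {v : (Fin 3 → ℝ) → (Fin 3 → ℝ)}
  (hvO : ∀ i, (fun y => v y i) =O[cocompact (Fin 3 → ℝ)] fun y => ‖y‖ ^ (1 : ℤ))
include hvO

/-- `|v|² = O(‖y‖²)`. -/
theorem isBigO_vSq_gauge : (fun y => fpSq (v y)) =O[cocompact (Fin 3 → ℝ)] fun y => ‖y‖ ^ (2 : ℤ) := by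
  have h : ∀ i : Fin 3, (fun y => v y i ^ 2) =O[cocompact (Fin 3 → ℝ)] fun y => ‖y‖ ^ (2 : ℤ) :=
    fun i => isBigO_gauge_up (isBigO_gauge_pow (hvO i) 2) (by norm_num)
  exact ((h 0).add (h 1)).add (h 2)

/-- `v₀² + v₁² + v₂² = O(‖y‖²)` (the spelled-out form used in `fpNum` and `fpDivFlux`). -/
theorem isBigO_vSq_gauge' :
    (fun y => v y 0 ^ 2 + v y 1 ^ 2 + v y 2 ^ 2) =O[cocompact (Fin 3 → ℝ)] fun y => ‖y‖ ^ (2 : ℤ) := by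
  have h : ∀ i : Fin 3, (fun y => v y i ^ 2) =O[cocompact (Fin 3 → ℝ)] fun y => ‖y‖ ^ (2 : ℤ) :=
    fun i => isBigO_gauge_up (isBigO_gauge_pow (hvO i) 2) (by norm_num)
  exact ((h 0).add (h 1)).add (h 2)

/-- `⟪y, v⟫ = O(‖y‖²)`. -/
theorem isBigO_vDot_gauge : (fun y => fpDot y (v y)) =O[cocompact (Fin 3 → ℝ)] fun y => ‖y‖ ^ (2 : ℤ) := by
  have h : ∀ i : Fin 3, (fun y : Fin 3 → ℝ => y i * v y i) =O[cocompact (Fin 3 → ℝ)] fun y => ‖y‖ ^ (2 : ℤ) :=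
    fun i => isBigO_gauge_up (isBigO_gauge_mul' (isBigO_coord_gauge i) (hvO i)) (by norm_num)
  exact ((h 0).add (h 1)).add (h 2)

/-- `⟪eₖ, v⟫ = O(‖y‖)`. -/
theorem isBigO_Edot_gauge (k : Fin 3) :
    (fun y => fpDot (fpE k) (v y)) =O[cocompact (Fin 3 → ℝ)] fun y => ‖y‖ ^ (1 : ℤ) := by
  have h : ∀ i : Fin 3, (fun y : Fin 3 → ℝ => fpE k i * v y i) =O[cocompact (Fin 3 → ℝ)] fun y => ‖y‖ ^ (1 : ℤ) :=
    fun i => isBigO_gauge_up (isBigO_gauge_mul' (isBigO_const_gauge (fpE k i)) (hvO i)) (by norm_num)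
  exact ((h 0).add (h 1)).add (h 2)

end growthV

section growthG
variable {v : (Fin 3 → ℝ) → (Fin 3 → ℝ)}
  (hGO : ∀ i j, (fun y => fpGrad v y i j) =O[cocompact (Fin 3 → ℝ)] fun y => ‖y‖ ^ (0 : ℤ))
include hGO

/-- `tr ∇v = O(1)`. -/
theorem isBigO_tr_gauge : (fun y => fpTr (fpGrad v y)) =O[cocompact (Fin 3 → ℝ)] fun y => ‖y‖ ^ (0 : ℤ) :=
  ((hGO 0 0).add (hGO 1 1)).add (hGO 2 2)

/-- `|∇v|² = O(1)`. -/
theorem isBigO_frob_gauge : (fun y => fpFrob (fpGrad v y)) =O[cocompact (Fin 3 → ℝ)] fun y => ‖y‖ ^ (0 : ℤ) := by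
  have h : ∀ i j : Fin 3, (fun y => fpGrad v y i j ^ 2) =O[cocompact (Fin 3 → ℝ)] fun y => ‖y‖ ^ (0 : ℤ) :=
    fun i j => isBigO_gauge_up (isBigO_gauge_pow (hGO i j) 2) (by norm_num)
  exact (((((((((h 0 0).add (h 0 1)).add (h 0 2)).add (h 1 0)).add (h 1 1)).add (h 1 2)).add (h 2 0)).add
    (h 2 1)).add (h 2 2))

/-- `|sym ∇v|² = O(1)`. -/
theorem isBigO_symSq_gauge : (fun y => fpSymSq (fpGrad v y)) =O[cocompact (Fin 3 → ℝ)] fun y => ‖y‖ ^ (0 : ℤ) := by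
  have h : ∀ i j : Fin 3, (fun y => fpGrad v y i j ^ 2) =O[cocompact (Fin 3 → ℝ)] fun y => ‖y‖ ^ (0 : ℤ) :=
    fun i j => isBigO_gauge_up (isBigO_gauge_pow (hGO i j) 2) (by norm_num)
  have h2 : ∀ i j : Fin 3, (fun y => 2 * ((fpGrad v y i j + fpGrad v y j i) / 2) ^ 2) =O[cocompact (Fin 3 → ℝ)]
      fun y => ‖y‖ ^ (0 : ℤ) :=
    fun i j => (isBigO_gauge_up (isBigO_gauge_pow (isBigO_gauge_div_const ((hGO i j).add (hGO j i)) 2) 2)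
      (by norm_num)).const_mul_left 2
  exact (((((h 0 0).add (h 1 1)).add (h 2 2)).add (h2 0 1)).add (h2 0 2)).add (h2 1 2)

/-- `Rec(∇v) = O(1)`. -/
theorem isBigO_rec_gauge : (fun y => fpRec (fpGrad v y)) =O[cocompact (Fin 3 → ℝ)] fun y => ‖y‖ ^ (0 : ℤ) :=
  (isBigO_gauge_up ((isBigO_gauge_pow (isBigO_tr_gauge hGO) 2).add
    ((isBigO_symSq_gauge hGO).const_mul_left 2)) (by norm_num)).const_mul_left (4 / 5)

/-- `Σᵢ yᵢ ∂ₖvᵢ = O(‖y‖)`. -/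
theorem isBigO_xGrow_gauge (k : Fin 3) :
    (fun y : Fin 3 → ℝ => y 0 * fpGrad v y k 0 + y 1 * fpGrad v y k 1 + y 2 * fpGrad v y k 2)
      =O[cocompact (Fin 3 → ℝ)] fun y => ‖y‖ ^ (1 : ℤ) := by
  have h : ∀ i : Fin 3, (fun y : Fin 3 → ℝ => y i * fpGrad v y k i) =O[cocompact (Fin 3 → ℝ)]
      fun y => ‖y‖ ^ (1 : ℤ) :=
    fun i => isBigO_gauge_up (isBigO_gauge_mul' (isBigO_coord_gauge i) (hGO k i)) (by norm_num)
  exact ((h 0).add (h 1)).add (h 2)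

/-- **Receipts density `Den(y, ∇v) = O(‖y‖⁻⁶)`**. -/
theorem isBigO_fpDen_gauge :
    (fun y => fpDen y (fpGrad v y)) =O[cocompact (Fin 3 → ℝ)] fun y => ‖y‖ ^ (-6 : ℤ) :=
  isBigO_gauge_up (isBigO_gauge_mul' (isBigO_fpSq_inv_pow_gauge 3) (isBigO_rec_gauge hGO)) (by norm_num)

end growthG

section growthVG
variable {v : (Fin 3 → ℝ) → (Fin 3 → ℝ)}
  (hvO : ∀ i, (fun y => v y i) =O[cocompact (Fin 3 → ℝ)] fun y => ‖y‖ ^ (1 : ℤ))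
  (hGO : ∀ i j, (fun y => fpGrad v y i j) =O[cocompact (Fin 3 → ℝ)] fun y => ‖y‖ ^ (0 : ℤ))
include hvO hGO

/-- Row contraction `Σᵢ vᵢ ∂ₖvᵢ = O(‖y‖)`. -/
theorem isBigO_vGrow_gauge (k : Fin 3) :
    (fun y => v y 0 * fpGrad v y k 0 + v y 1 * fpGrad v y k 1 + v y 2 * fpGrad v y k 2) =O[cocompact (Fin 3 → ℝ)]
      fun y => ‖y‖ ^ (1 : ℤ) := by
  have h : ∀ i : Fin 3, (fun y => v y i * fpGrad v y k i) =O[cocompact (Fin 3 → ℝ)] fun y => ‖y‖ ^ (1 : ℤ) :=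
    fun i => isBigO_gauge_up (isBigO_gauge_mul' (hvO i) (hGO k i)) (by norm_num)
  exact ((h 0).add (h 1)).add (h 2)

/-- Column contraction minus trace part `Σᵢ vᵢ ∂ᵢvⱼ − (div v) vⱼ = O(‖y‖)`. -/
theorem isBigO_vGcol_gauge (j : Fin 3) :
    (fun y => v y 0 * fpGrad v y 0 j + v y 1 * fpGrad v y 1 j + v y 2 * fpGrad v y 2 j - fpTr (fpGrad v y) * v y j)
      =O[cocompact (Fin 3 → ℝ)] fun y => ‖y‖ ^ (1 : ℤ) := by
  have h : ∀ i : Fin 3, (fun y => v y i * fpGrad v y i j) =O[cocompact (Fin 3 → ℝ)] fun y => ‖y‖ ^ (1 : ℤ) :=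
    fun i => isBigO_gauge_up (isBigO_gauge_mul' (hvO i) (hGO i j)) (by norm_num)
  exact (((h 0).add (h 1)).add (h 2)).sub
    (isBigO_gauge_up (isBigO_gauge_mul' (isBigO_tr_gauge hGO) (hvO j)) (by norm_num))

/-- **Demand density `Num(y, v, ∇v) = O(‖y‖⁻⁶)`** along a linear-growth field. -/
theorem isBigO_fpNum_gauge :
    (fun y => fpNum y (v y) (fpGrad v y)) =O[cocompact (Fin 3 → ℝ)] fun y => ‖y‖ ^ (-6 : ℤ) := by
  have h1 : (fun y => 1 / 24 * (fpSq y)⁻¹ ^ 3 * fpFrob (fpGrad v y)) =O[cocompact (Fin 3 → ℝ)]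
      fun y => ‖y‖ ^ (-6 : ℤ) :=
    isBigO_gauge_up (isBigO_gauge_mul' (isBigO_gauge_mul' (isBigO_const_gauge (1 / 24))
      (isBigO_fpSq_inv_pow_gauge 3)) (isBigO_frob_gauge hGO)) (by norm_num)
  have h2 : (fun y => 2 * (fpSq y)⁻¹ ^ 5 * fpDot y (v y) ^ 2) =O[cocompact (Fin 3 → ℝ)]
      fun y => ‖y‖ ^ (-6 : ℤ) :=
    isBigO_gauge_up (isBigO_gauge_mul' (isBigO_gauge_mul' (isBigO_const_gauge 2)
      (isBigO_fpSq_inv_pow_gauge 5)) (isBigO_gauge_pow (isBigO_vDot_gauge hvO) 2)) (by norm_num)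
  have h3 : (fun y => 1 / 4 * (fpSq y)⁻¹ ^ 4 * (v y 0 ^ 2 + v y 1 ^ 2 + v y 2 ^ 2)) =O[cocompact (Fin 3 → ℝ)]
      fun y => ‖y‖ ^ (-6 : ℤ) :=
    isBigO_gauge_up (isBigO_gauge_mul' (isBigO_gauge_mul' (isBigO_const_gauge (1 / 4))
      (isBigO_fpSq_inv_pow_gauge 4)) (isBigO_vSq_gauge' hvO)) (by norm_num)
  exact (h1.add h2).sub h3

/-- **Flux `Φⱼ = O(‖y‖⁻⁵)`**. -/
theorem isBigO_fpFlux_gauge (j : Fin 3) :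
    (fun y => fpFlux v y j) =O[cocompact (Fin 3 → ℝ)] fun y => ‖y‖ ^ (-5 : ℤ) := by
  have hA : (fun y => fpSq (v y) * y j + 7 * fpDot y (v y) * v y j) =O[cocompact (Fin 3 → ℝ)]
      fun y => ‖y‖ ^ (3 : ℤ) :=
    (isBigO_gauge_up (isBigO_gauge_mul' (isBigO_vSq_gauge hvO) (isBigO_coord_gauge j)) (by norm_num)).add
      (isBigO_gauge_up (isBigO_gauge_mul' (isBigO_gauge_mul' (isBigO_const_gauge 7) (isBigO_vDot_gauge hvO))
        (hvO j)) (by norm_num))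
  have h1 := isBigO_gauge_mul' (isBigO_fpSq_inv_pow_gauge 4) hA
  have h2 := isBigO_gauge_mul' (isBigO_fpSq_inv_pow_gauge 3) (isBigO_vGcol_gauge hvO hGO j)
  exact (isBigO_gauge_up h1 (by norm_num)).add (isBigO_gauge_up h2 (by norm_num))

end growthVG

end Summit.AtomisticToContinuum.Crystallization.Theorems.StrictSplittingRuleBirth
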